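import Literature.NumberTheory.GaloisRepresentations.UniformizerResidueIndex
import Mathlib.RingTheory.LocalRing.ResidueField.Basic
import Mathlib.RingTheory.IntegralDomain
import Mathlib.FieldTheory.Finite.Basic
import Mathlib.Algebra.Polynomial.AlgebraMap
import HarnessLib

/-!
# Tate's almost étale lemma — Teichmüller digits and `ϖ`-adic approximation in a local field
# (toward Serre III §6 Prop. 12: the integers of a finite extension of `ℚ_p` are monogenic)

Setting: `L` a non-trivially normed ultrametric field which is locally compact (`ProperSpace L`) — the
norm-side avatar of a `p`-adic field used by the tree's `NormUniformizer` / `UniformizerResidueIndex`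
(norm uniformizer `ϖ`, valuation ring `𝒪 = {‖x‖ ≤ 1}` = `Valued.integer L` for the scoped instance
`NormedField.toValued`, finite residue field `k = 𝒪/𝔪`).  We prove the two elementary facts behind
Serre's construction of a generator of the integers (Serre, *Local Fields* III §6 Prop. 12, with
`x̄` a generator of `k^×` and the polynomial `X^{q−1} − 1` in place of the minimal polynomial of `x̄`):

* `exists_generator_digits` (**Teichmüller digits and a uniformizer in `ℤ[x]`**): there is an integral
  `x ∈ L` and `q ≥ 2` (`q = #k`) such that (i) every integral `z` is congruent modulo `𝔪` to `0` or to
  some power `x^i` (`x̄` generates `k^×`), and (ii) `‖x^{q−1} − 1‖ = ‖ϖ‖` — `x^{q−1} − 1` is a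
  uniformizer (if `x₀` lifts a generator of `k^×`, either `x₀` works or `x₀(1 + ϖ)` does, since
  `(1+ϖ)^{q−1} − 1 ≡ (q−1)ϖ (mod ϖ²)` and `q − 1` is a unit);
* `exists_intPoly_norm_sub_le_pow` (**`ϖ`-adic expansion with digits in `ℤ[x]`**): consequently every
  integral `z` is approximated by integer polynomials in `x` to any order:
  `∀ M, ∃ P ∈ ℤ[X], ‖z − P(x)‖ ≤ ‖ϖ‖^M`.

The compactness step (`ℤ_p[x]` is closed) that turns the approximation into `𝒪_Ω = ℤ_p[x]` for a
finite extension `Ω` of `ℚ_p` is the file `TateAlmostEtaleMonogenic`.  Pure local algebra; no `sorry`,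
no definitions.

References: J.-P. Serre, *Local Fields*, Ch. III §6 Prop. 12, Ch. II §4 Prop. 8 (Teichmüller
representatives) [SerreLocalFields1979].
-/

noncomputable section

open scoped Classical NormedField
open Polynomial IsLocalRing

namespace Literature.NumberTheory.PAdicHodge.TateAlmostEtale

open Literature.NumberTheory.GaloisRepresentations.Ultrametric

section Local

variable {L : Type*} [NontriviallyNormedField L] [IsUltrametricDist L]

/-! ## Residues and norms -/

/-- Two integers have the same residue iff their difference has norm `< 1`. [cite: SerreLocalFields1979, Ch. II §4 (residue field of a valuation ring)] -/
theorem residue_eq_residue_iff_norm_sub_lt_one (a b : Valued.integer L) :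
    residue (Valued.integer L) a = residue (Valued.integer L) b ↔ ‖(a : L) - b‖ < 1 := by
  rw [← sub_eq_zero, ← map_sub, residue_eq_zero_iff, mem_maximalIdeal_iff_norm_lt_one]
  rfl

/-- An integer has residue `0` iff its norm is `< 1`. [cite: SerreLocalFields1979, Ch. II §4] -/
theorem residue_eq_zero_iff_norm_lt_one (a : Valued.integer L) :
    residue (Valued.integer L) a = 0 ↔ ‖(a : L)‖ < 1 := by
  rw [residue_eq_zero_iff, mem_maximalIdeal_iff_norm_lt_one]; rfl

/-- `‖(1 + ϖ)^n − 1 − n ϖ‖ ≤ ‖ϖ‖²` for `‖ϖ‖ ≤ 1` (binomial expansion, ultrametric).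
[cite: SerreLocalFields1979, Ch. III §6 Prop. 12 (proof: Taylor expansion to first order)] -/
theorem norm_one_add_pow_sub_le (ϖ : L) (hϖ : ‖ϖ‖ ≤ 1) (n : ℕ) :
    ‖(1 + ϖ) ^ n - 1 - n * ϖ‖ ≤ ‖ϖ‖ ^ 2 := by
  induction n with
  | zero => simp
  | succ n ih =>
    have e : (1 + ϖ) ^ (n + 1) - 1 - (↑(n + 1) : L) * ϖ =
        ((1 + ϖ) ^ n - 1 - n * ϖ) * (1 + ϖ) + n * ϖ ^ 2 := by
      push_cast; ring
    rw [e]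
    refine (IsUltrametricDist.norm_add_le_max _ _).trans (max_le ?_ ?_)
    · rw [norm_mul]
      refine (mul_le_mul ih ((IsUltrametricDist.norm_add_le_max _ _).trans
        (max_le (by rw [norm_one]) hϖ)) (norm_nonneg _) (sq_nonneg _)).trans (mul_one _).le
    · rw [norm_mul, norm_pow]
      exact (mul_le_of_le_one_left (sq_nonneg _) (IsUltrametricDist.norm_natCast_le_one L n))

variable [ProperSpace L]

/-- **Teichmüller digits and a uniformizer in `ℤ[x]`** (Serre III §6 Prop. 12, with `x̄` a generator
of `k^×`): for a locally compact non-trivially normed ultrametric field `L` with norm uniformizer `ϖ`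
there are an integral `x ∈ L` and `q ≥ 2` such that every integral `z` satisfies `‖z‖ < 1` or
`‖z − x^i‖ < 1` for some `i < q − 1`, and `‖x^{q−1} − 1‖ = ‖ϖ‖`.
[cite: SerreLocalFields1979, Ch. III §6 Prop. 12 and Ch. II §4 Prop. 8] -/
theorem exists_generator_digits {ϖ : Lˣ} (hϖ : IsUniformizer ϖ) :
    ∃ (x : L) (q : ℕ), ‖x‖ ≤ 1 ∧ 2 ≤ q ∧
      (∀ z : L, ‖z‖ ≤ 1 → ‖z‖ < 1 ∨ ∃ i < q - 1, ‖z - x ^ i‖ < 1) ∧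
      ‖x ^ (q - 1) - 1‖ = ‖(ϖ : L)‖ := by
  -- the residue field and a generator of its unit group
  haveI : Finite (ResidueField (Valued.integer L)) := finite_residueField
  letI : Fintype (ResidueField (Valued.integer L)) := Fintype.ofFinite _
  set k := ResidueField (Valued.integer L)
  set q : ℕ := Fintype.card k with hq
  have hq2 : 2 ≤ q := by
    rw [hq, ← Nat.card_eq_fintype_card]; exact hϖ.two_le_card_residueField
  obtain ⟨g, hg⟩ := IsCyclic.exists_generator (α := kˣ)
  have hgord : orderOf g = q - 1 := by
    rw [orderOf_eq_card_of_forall_mem_zpowers hg, Nat.card_eq_fintype_card, Fintype.card_units, hq]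
  -- every unit of `k` is `g^i`, `i < q - 1`
  have hpow : ∀ u : kˣ, ∃ i < q - 1, g ^ i = u := by
    intro u
    have hu : u ∈ Submonoid.powers g := (mem_powers_iff_mem_zpowers).mpr (hg u)
    rw [mem_powers_iff_mem_range_orderOf, Finset.mem_image] at hu
    obtain ⟨i, hi, rfl⟩ := hu
    exact ⟨i, by rw [← hgord]; exact Finset.mem_range.mp hi, rfl⟩
  -- a lift `x₀` of `g`
  obtain ⟨x₀, hx₀⟩ := residue_surjective (R := Valued.integer L) (g : k)
  -- digits and the congruence `x^{q-1} ≡ 1` for ANY lift `x` of `g`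
  have hdig : ∀ x : Valued.integer L, residue (Valued.integer L) x = (g : k) →
      (∀ z : L, ‖z‖ ≤ 1 → ‖z‖ < 1 ∨ ∃ i < q - 1, ‖z - (x : L) ^ i‖ < 1) ∧
      ‖(x : L) ^ (q - 1) - 1‖ < 1 := by
    intro x hx
    constructor
    · intro z hz
      let zO : Valued.integer L := ⟨z, Valued.integer.mem_iff.mpr hz⟩
      by_cases h0 : residue (Valued.integer L) zO = 0
      · exact Or.inl ((residue_eq_zero_iff_norm_lt_one zO).mp h0)
      · right
        obtain ⟨i, hi, hgi⟩ := hpow (Units.mk0 _ h0)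
        refine ⟨i, hi, ?_⟩
        have : residue (Valued.integer L) zO = residue (Valued.integer L) (x ^ i) := by
          rw [map_pow, hx, ← Units.val_pow_eq_pow_val, hgi]; rfl
        have h := (residue_eq_residue_iff_norm_sub_lt_one zO (x ^ i)).mp this
        simpa using h
    · have : residue (Valued.integer L) (x ^ (q - 1)) = residue (Valued.integer L) 1 := by
        rw [map_pow, hx, map_one, ← Units.val_pow_eq_pow_val, ← hgord, pow_orderOf_eq_one,
          Units.val_one]
      have h := (residue_eq_residue_iff_norm_sub_lt_one (x ^ (q - 1)) 1).mp this
      simpa using h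
  -- `‖q − 1‖ = 1`
  have hq1 : ‖((q - 1 : ℕ) : L)‖ = 1 := by
    have hqO : residue (Valued.integer L) (q : Valued.integer L) = 0 := by
      rw [map_natCast, hq]; exact FiniteField.cast_card_eq_zero k
    have hqn : ‖(q : L)‖ < 1 := by
      have := (residue_eq_zero_iff_norm_lt_one (q : Valued.integer L)).mp hqO
      simpa using this
    have e : ((q - 1 : ℕ) : L) = (q : L) + (-1) := by
      rw [Nat.cast_sub (by omega : 1 ≤ q)]; push_cast; ring
    rw [e, IsUltrametricDist.norm_add_eq_max_of_norm_ne_norm, norm_neg, norm_one, max_eq_right hqn.le]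
    rw [norm_neg, norm_one]; exact hqn.ne
  -- choose `x = x₀` or `x = x₀ (1 + ϖ)`
  have hx₀1 : ‖(x₀ : L)‖ ≤ 1 := Valued.integer.norm_le_one x₀
  obtain ⟨hdig₀, hcong₀⟩ := hdig x₀ hx₀
  by_cases hcase : ‖(x₀ : L) ^ (q - 1) - 1‖ = ‖(ϖ : L)‖
  · exact ⟨x₀, q, hx₀1, hq2, hdig₀, hcase⟩
  · -- `‖x₀^{q-1} − 1‖ ≤ ‖ϖ‖²`
    have hsmall : ‖(x₀ : L) ^ (q - 1) - 1‖ ≤ ‖(ϖ : L)‖ ^ 2 := by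
      by_cases h0 : (x₀ : L) ^ (q - 1) - 1 = 0
      · rw [h0, norm_zero]; exact sq_nonneg _
      · obtain ⟨j, hj⟩ := hϖ.2 (Units.mk0 _ h0)
        rw [Units.val_mk0] at hj
        rw [hj] at hcong₀ hcase ⊢
        have hϖ1 := hϖ.norm_lt_one
        have hϖ0 : 0 < ‖(ϖ : L)‖ := norm_pos_iff.mpr ϖ.ne_zero
        have hj1 : 1 ≤ j := by
          by_contra h
          push Not at h
          exact absurd hcong₀ (not_lt.mpr (one_le_zpow_of_nonpos₀ hϖ0 hϖ1.le (by omega)))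
        have hj2 : 2 ≤ j := by
          rcases eq_or_lt_of_le hj1 with h | h
          · exact absurd (by rw [← h, zpow_one]) hcase
          · omega
        rw [← zpow_natCast]
        exact zpow_le_zpow_right_of_le_one₀ hϖ0 hϖ1.le (by exact_mod_cast hj2)
    -- the new generator
    set x : L := (x₀ : L) * (1 + ϖ) with hxdef
    have h1ϖ : ‖(1 + (ϖ : L))‖ ≤ 1 :=
      (IsUltrametricDist.norm_add_le_max _ _).trans (max_le (by rw [norm_one]) hϖ.norm_lt_one.le)
    have hx1 : ‖x‖ ≤ 1 := by rw [hxdef, norm_mul]; exact mul_le_one₀ hx₀1 (norm_nonneg _) h1ϖ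
    let xO : Valued.integer L := ⟨x, Valued.integer.mem_iff.mpr hx1⟩
    have hxres : residue (Valued.integer L) xO = (g : k) := by
      rw [← hx₀, residue_eq_residue_iff_norm_sub_lt_one]
      change ‖(x₀ : L) * (1 + ϖ) - x₀‖ < 1
      rw [show (x₀ : L) * (1 + ϖ) - x₀ = x₀ * ϖ by ring, norm_mul]
      exact (mul_le_of_le_one_left (norm_nonneg _) hx₀1).trans_lt hϖ.norm_lt_one
    obtain ⟨hdigx, -⟩ := hdig xO hxres
    refine ⟨x, q, hx1, hq2, hdigx, ?_⟩
    -- `x^{q-1} − 1 = s (q−1) ϖ + (s E + (s − 1))`, `s = x₀^{q−1}`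
    set s : L := (x₀ : L) ^ (q - 1) with hs
    set E : L := (1 + ϖ) ^ (q - 1) - 1 - (q - 1 : ℕ) * ϖ with hE
    have hEn : ‖E‖ ≤ ‖(ϖ : L)‖ ^ 2 := norm_one_add_pow_sub_le _ hϖ.norm_lt_one.le _
    have hs1 : ‖s‖ = 1 := by
      have : ‖s - 1‖ < 1 := hcong₀
      have h := IsUltrametricDist.norm_add_eq_max_of_norm_ne_norm
        (x := s - 1) (y := (1 : L)) (by rw [norm_one]; exact this.ne)
      rw [sub_add_cancel, norm_one, max_eq_right this.le] at h
      exact h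
    have e : x ^ (q - 1) - 1 = s * ((q - 1 : ℕ) * ϖ) + (s * E + (s - 1)) := by
      rw [hxdef, mul_pow, hE]; ring
    have hmain : ‖s * ((q - 1 : ℕ) * (ϖ : L))‖ = ‖(ϖ : L)‖ := by
      rw [norm_mul, norm_mul, hs1, hq1, one_mul, one_mul]
    have hrest : ‖s * E + (s - 1)‖ < ‖(ϖ : L)‖ := by
      have hϖ0 : 0 < ‖(ϖ : L)‖ := norm_pos_iff.mpr ϖ.ne_zero
      have hsq : ‖(ϖ : L)‖ ^ 2 < ‖(ϖ : L)‖ := by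
        rw [sq]; exact mul_lt_of_lt_one_left hϖ0 hϖ.norm_lt_one
      refine (IsUltrametricDist.norm_add_le_max _ _).trans_lt (max_lt ?_ (hsmall.trans_lt hsq))
      rw [norm_mul, hs1, one_mul]; exact hEn.trans_lt hsq
    rw [e, IsUltrametricDist.norm_add_eq_max_of_norm_ne_norm, hmain, max_eq_left hrest.le]
    rw [hmain]; exact hrest.ne'

omit [IsUltrametricDist L] [ProperSpace L] in
/-- **`ϖ`-adic approximation by integer polynomials** (the existence half of Serre III §6 Prop. 12,
`𝒪 = A[x]`, before completion): if every integral `z` is within norm `< 1` of `0` or of a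
power of `x`, every element of norm `< 1` has norm `≤ ρ := ‖R(x)‖` for some `R ∈ ℤ[X]` with
`0 < ρ`, then for every `M` and every integral `z` there is `P ∈ ℤ[X]` with `‖z − P(x)‖ ≤ ρ^M`.
[cite: SerreLocalFields1979, Ch. III §6 Prop. 12 (proof) and Ch. II §4 Prop. 8] -/
theorem exists_intPoly_norm_sub_le_pow {x : L}
    (hdig : ∀ z : L, ‖z‖ ≤ 1 → ‖z‖ < 1 ∨ ∃ i : ℕ, ‖z - x ^ i‖ < 1)
    (R : ℤ[X]) (hR0 : 0 < ‖aeval x R‖) (hunif : ∀ z : L, ‖z‖ < 1 → ‖z‖ ≤ ‖aeval x R‖)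
    (M : ℕ) (z : L) (hz : ‖z‖ ≤ 1) : ∃ P : ℤ[X], ‖z - aeval x P‖ ≤ ‖aeval x R‖ ^ M := by
  induction M generalizing z with
  | zero => exact ⟨0, by rw [map_zero, sub_zero, pow_zero]; exact hz⟩
  | succ M ih =>
    obtain ⟨P, hP⟩ := ih z hz
    set ρ : ℝ := ‖aeval x R‖ with hρ
    have hπ0 : aeval x R ≠ 0 := norm_pos_iff.mp hR0
    -- `w = (z − P(x)) / R(x)^M` is integral
    set w : L := (z - aeval x P) / aeval x R ^ M with hw
    have hw1 : ‖w‖ ≤ 1 := by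
      rw [hw, norm_div, norm_pow, div_le_one (pow_pos hR0 _)]; exact hP
    have hzw : z - aeval x P = aeval x R ^ M * w := by
      rw [hw, mul_div_cancel₀ _ (pow_ne_zero _ hπ0)]
    -- a digit `D ∈ {0, X^i}` with `‖w − D(x)‖ ≤ ρ`
    obtain ⟨D, hD⟩ : ∃ D : ℤ[X], ‖w - aeval x D‖ ≤ ρ := by
      rcases hdig w hw1 with h | ⟨i, hi⟩
      · exact ⟨0, by rw [map_zero, sub_zero]; exact hunif w h⟩
      · exact ⟨X ^ i, by rw [map_pow, aeval_X]; exact hunif _ hi⟩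
    refine ⟨P + D * R ^ M, ?_⟩
    have e : z - aeval x (P + D * R ^ M) = aeval x R ^ M * (w - aeval x D) := by
      rw [map_add, map_mul, map_pow, ← sub_sub, hzw]; ring
    rw [e, norm_mul, norm_pow, pow_succ]
    exact mul_le_mul_of_nonneg_left hD (pow_nonneg (norm_nonneg _) _)

end Local

end Literature.NumberTheory.PAdicHodge.TateAlmostEtale

end
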